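import Summits.NavierStokesRegularity.NavierStokesRegularity.Theses.ExtremiserTransience
import Summits.NavierStokesRegularity.NavierStokesRegularity.Theorems.ExtremiserTransienceNearExtremalTransienceDSSLogMean
import Summits.NavierStokesRegularity.NavierStokesRegularity.Theorems.ExtremiserTransienceNearExtremalTransienceSharpConstant
import Literature.Analysis.FluidPDE.BlowupAncientSolution
import Literature.Analysis.FluidPDE.NSBoundedMildOseen
import Literature.Analysis.FluidPDE.MildSolution
import HarnessLib.Audit

/-!
# Skeleton of the crux `ExtremiserTransience.NearExtremalTransience` — line `extremiser_liouville` (v1)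
(crux item `stmt-NavierStokesRegularity-21883`; D-0145 ideator seat `ns-idea-10` g2, lens «rescuer», 2026-08-28.)

THE RECORDED DEATH this line dodges.  `Lines/birth.md` (v1–v4, seat of record) diagnoses the crux as ATOMIC: a proof needs
(M1) the structure of near-maximisers of the stretching efficiency `R[v] = |∫⟪ω,Dv ω⟫|/(‖v‖∞‖ω‖₂‖∇ω‖₂)`, (M2) an EXIT /
non-recurrence ESTIMATE for the Leray-similarity flow near that set, UNIFORM over all Type-I singular flows, and it records
(M3) «no compactness of the class "classical Leray–Hopf rapidly-decaying datum on [0,T)" — limits of rescaled Type-I flows are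
ancient / local-energy solutions, outside the class; uniformity of θ cannot be bootstrapped from a per-flow statement inside
this formal class».  The line `intrinsic_flyby` (g0, this seat) dodged the CLOCK (envelope clock → dissipation clock).  The
present line dodges (M2)+(M3) themselves, by the move concentration-compactness/rigidity makes in critical dispersive and
parabolic problems (Kenig–Merle; Poláčik–Quittner–Souplet «Liouville ⇒ universal bounds»): a quantity that must be bounded
UNIFORMLY over a non-compact class is bounded by contradiction — failure of uniformity is COMPACTIFIED into one limiting
object (here: a bounded ancient mild solution in the KNSS blow-up-limit class) that inherits the EXTREMALITY, and a
LIOUVILLE theorem for extremal ancient solutions excludes the object.  No exit RATE is ever estimated (M2 becomes the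
qualitative rigidity K1), and the class that lacked compactness is replaced by the class that has it (M3 becomes K2, whose
engine is the C^∞_loc compactness of bounded mild solutions, KNSS 2009 §4 and Lemma 6.1 — tree
`Literature.Analysis.FluidPDE.KNSSMildCompactness`, `…AncientMildCompactness`, `…BlowupAncientSolution`).

DICTIONARY (checkable): critical norm ↦ the scale- and Galilei-covariant efficiency `R`; «energy does not tend to the
ground-state level» ↦ the PERSISTENCE SCENARIO `P` below (near-extremal log-time quadratic mean on windows of unbounded
log-length, along some Type-I singular flow, for levels β ↑ κ⋆²); critical element ↦ an EXTREMAL ANCIENT SOLUTION (a KNSS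
blow-up limit `W`, Oseen gauge, whose slices have sup-efficiency ≥ κ⋆ for a.e. time of an interval); rigidity theorem ↦
K1 (no such `W`; PROVED here from K1a analyticity + K1b a static variational exclusion).  The converse bookkeeping «¬P ⇒ the crux» is elementary real analysis and is PROVED in this file.

STUBS (3) and composition (kernel-checked, no sorry outside the stubs):
* `stub_extremalPersistenceCompactness` (K2, XL — load-bearing): P → an extremal ancient solution exists.
* `stub_analyticSlices` (K1a, M/L, known mechanism): slices of KNSS blow-up limits in the Oseen gauge are real-analytic.
* `stub_noAnalyticExtremal` (K1b, L, STATIC): no analytic bounded div-free field with finite (Z,P) is non-trivially κ⋆-efficient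
  (the tree's `KStar.not_attained_of_analyticOnNhd` without the L² hypothesis and with ≥ in place of =).
* `efficiency_subadditive` (PROVED, support): far-apart pieces are never jointly more efficient than the better piece; R-neutral
  splitting only at equal amplitude and equal Z/P ratio (Cauchy–Schwarz) — the algebraic half of K2's tightness step.
* `extremalAncient_false_of : K1a → K1b → K1` (PROVED): RIGIDITY — no extremal ancient solution exists (K1).
* `NearExtremalTransience_of : NearExtremalTransience` — uses the three registered stubs BY NAME (`have hK2 := stub_extremalPersistenceCompactness`,
  `have hK1 : K1 := extremalAncient_false_of stub_analyticSlices stub_noAnalyticExtremal`); the rest is the dynamic composition K2 → K1 → crux, so a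
  direct proof of K1 can be substituted verbatim: K1∘K2 give ¬P; ¬P produces β < κ⋆² and L > 0 such that
  along EVERY Type-I singular flow some admissible coefficient k has, after some onset t₁, mass ≤ β·(log-length) on every
  window of log-length ≥ L; geometric blocks of log-length exactly L then carry mass ≤ max β 0 · L, `blocksToLog_general`
  (tree, `…DSSLogMean`) sums them to `∫_(t₁)^t k²dτ/(T−τ) ≤ max β 0 · log((T−t₁)/(T−t)) + max β 0 · L`, and with
  θ := √(max β 0)/κ⋆ < 1 (κ⋆ > 13/200, `sharpDepletion_gt`) and κ⋆ ≤ κ for every universal κ (`sharpDepletion_le`) this is the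
  crux with B := max β 0 · L.
The statement ¬P («uniform windowed subextremality») is STRONGER than the crux (it forbids near-extremal windows of large but
zero-density log-length, which the crux tolerates — cf. `Lines/birth.md`, v3 vs v4); this is disclosed in `Lines/extremiser_liouville.md`
(§Transfer) together with the named tools that make K2 and K1 attackable.  No summit is proved by this line.

THE TWO OBJECTS (informal; the stubs carry the expanded Lean text over tree declarations only).
* PERSISTENCE SCENARIO `P` (hypothesis of K2): for every level β < κ⋆² and every log-length L > 0 there is a Type-I singular
  classical Leray–Hopf flow (exactly the binders of the crux: C ν T u p, classical on [0,T), Leray–Hopf, rapidly decaying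
  datum, eventual rate √(T−t)‖u‖ ≤ C√ν, no smooth extension past T) along which EVERY admissible depletion coefficient k
  (measurable, values in [0,1], flow-wise clause on [0,T)) has, after every onset t₁ < T, a window [s₁,s₂] ⊂ [t₁,T) of
  log-length log((T−s₁)/(T−s₂)) ≥ L with quadratic log-time mean above β: β·log((T−s₁)/(T−s₂)) < ∫_(s₁)^(s₂) k²dτ/(T−τ).
* EXTREMAL ANCIENT SOLUTION (conclusion of K2, excluded by K1): a KNSS blow-up limit `W` (tree class
  `Literature.Analysis.FluidPDE.IsKNSSBlowupLimit`: bounded ancient mild solution at unit viscosity on (−∞,0)×ℝ³, smooth,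
  |W| ≤ 1 = sup|W|) in the OSEEN GAUGE (the KNSS integral identity `W t = e^{(t−s)Δ}W s − B¹_s(W,W)(t)` between every pair
  of times s < t < 0 — tree `heatFlow`, `oseenDuhamel` — which excludes the parasitic solutions x ↦ b(t)), and a time interval
  (a,b), b ≤ 0, such that for a.e. t ∈ (a,b) the slice W(t) is EXTREMAL: smooth, divergence-free, bounded gradient, finite
  enstrophy Z = ‖curl W(t)‖₂² and palinstrophy P = ‖∇curl W(t)‖₂² (NO L² condition on W(t) itself — blow-up limits are not
  square integrable), non-trivial (M·√Z·√P > 0) and of sup-efficiency at least the sharp constant κ⋆ = sInf of the universal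
  depletion constants (tree `sharpDepletion_*`): κ⋆·M·√Z·√P ≤ |∫⟪curl W(t), DW(t) curl W(t)⟫| for some bound M ≥ |W(t)|
  (equivalently for M = sup|W(t)|, since κ⋆ ≥ 0).
-/

noncomputable section

open Set MeasureTheory Filter Topology
open scoped InnerProductSpace RealInnerProductSpace ENNReal

namespace Summit.NavierStokesRegularity.NavierStokesRegularity.Cruxes.NearExtremalTransience.ExtremiserLiouville

open Summit.NavierStokesRegularity.NavierStokesRegularity.Theses.ExtremiserTransience
open Summit.NavierStokesRegularity.NavierStokesRegularity.Theorems
open Summit.NavierStokesRegularity.NavierStokesRegularity.Theorems.DepletionLadder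

set_option linter.unusedVariables false
set_option linter.dupNamespace false
set_option linter.style.longLine false

/-- **Support (PROVED): tightness algebra for the efficiency functional** — the algebraic half of K2's step (iii): two far-apart pieces with additive (S, Z, P) and
sup-amplitudes M₁, M₂ cannot be jointly MORE efficient than the better piece; the chain of inequalities is
|S₁+S₂| ≤ |S₁|+|S₂| ≤ R (M₁√Z₁√P₁ + M₂√Z₂√P₂) ≤ R max(M₁,M₂) (√Z₁√P₁ + √Z₂√P₂) ≤ R max(M₁,M₂) √(Z₁+Z₂) √(P₁+P₂),
with equality in the last two steps only at equal amplitude and equal ratio Z₁/P₁ = Z₂/P₂ (Cauchy–Schwarz). -/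
theorem efficiency_subadditive {S₁ S₂ Z₁ Z₂ P₁ P₂ M₁ M₂ R : ℝ}
    (hZ₁ : 0 ≤ Z₁) (hZ₂ : 0 ≤ Z₂) (hP₁ : 0 ≤ P₁) (hP₂ : 0 ≤ P₂) (hM₁ : 0 ≤ M₁) (hR : 0 ≤ R)
    (h₁ : |S₁| ≤ R * M₁ * Real.sqrt Z₁ * Real.sqrt P₁) (h₂ : |S₂| ≤ R * M₂ * Real.sqrt Z₂ * Real.sqrt P₂) :
    |S₁ + S₂| ≤ R * max M₁ M₂ * Real.sqrt (Z₁ + Z₂) * Real.sqrt (P₁ + P₂) := by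
  set a := Real.sqrt Z₁ with ha
  set b := Real.sqrt Z₂ with hb
  set c := Real.sqrt P₁ with hc
  set d := Real.sqrt P₂ with hd
  have ha0 : 0 ≤ a := Real.sqrt_nonneg _
  have hb0 : 0 ≤ b := Real.sqrt_nonneg _
  have hc0 : 0 ≤ c := Real.sqrt_nonneg _
  have hd0 : 0 ≤ d := Real.sqrt_nonneg _
  have hZ : Real.sqrt (Z₁ + Z₂) = Real.sqrt (a ^ 2 + b ^ 2) := by
    rw [ha, hb, Real.sq_sqrt hZ₁, Real.sq_sqrt hZ₂]
  have hP : Real.sqrt (P₁ + P₂) = Real.sqrt (c ^ 2 + d ^ 2) := by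
    rw [hc, hd, Real.sq_sqrt hP₁, Real.sq_sqrt hP₂]
  -- Cauchy–Schwarz in ℝ²
  have key0 : a * c + b * d ≤ Real.sqrt ((a ^ 2 + b ^ 2) * (c ^ 2 + d ^ 2)) := by
    refine (le_abs_self _).trans (Real.abs_le_sqrt ?_)
    nlinarith [sq_nonneg (a * d - b * c)]
  have key : a * c + b * d ≤ Real.sqrt (a ^ 2 + b ^ 2) * Real.sqrt (c ^ 2 + d ^ 2) := by
    have hsplit : Real.sqrt ((a ^ 2 + b ^ 2) * (c ^ 2 + d ^ 2)) =
        Real.sqrt (a ^ 2 + b ^ 2) * Real.sqrt (c ^ 2 + d ^ 2) := Real.sqrt_mul (by positivity) _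
    rw [← hsplit]; exact key0
  have hmax₁ : M₁ ≤ max M₁ M₂ := le_max_left _ _
  have hmax₂ : M₂ ≤ max M₁ M₂ := le_max_right _ _
  have hmax0 : 0 ≤ max M₁ M₂ := hM₁.trans hmax₁
  calc |S₁ + S₂| ≤ |S₁| + |S₂| := abs_add_le _ _
    _ ≤ R * M₁ * a * c + R * M₂ * b * d := add_le_add h₁ h₂
    _ ≤ R * max M₁ M₂ * a * c + R * max M₁ M₂ * b * d := by
        have h1 : R * M₁ * a * c ≤ R * max M₁ M₂ * a * c := by
          have : R * M₁ ≤ R * max M₁ M₂ := mul_le_mul_of_nonneg_left hmax₁ hR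
          have hac : 0 ≤ a * c := mul_nonneg ha0 hc0
          nlinarith
        have h2 : R * M₂ * b * d ≤ R * max M₁ M₂ * b * d := by
          have : R * M₂ ≤ R * max M₁ M₂ := mul_le_mul_of_nonneg_left hmax₂ hR
          have hbd : 0 ≤ b * d := mul_nonneg hb0 hd0
          nlinarith
        linarith
    _ = R * max M₁ M₂ * (a * c + b * d) := by ring
    _ ≤ R * max M₁ M₂ * (Real.sqrt (a ^ 2 + b ^ 2) * Real.sqrt (c ^ 2 + d ^ 2)) :=
        mul_le_mul_of_nonneg_left key (mul_nonneg hR hmax0)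
    _ = R * max M₁ M₂ * Real.sqrt (Z₁ + Z₂) * Real.sqrt (P₁ + P₂) := by rw [hZ, hP]; ring

/-- **K2 · stub_extremalPersistenceCompactness (crux of the line, XL; the load-bearing stub).**  PERSISTENCE COMPACTIFIES:
if near-extremal stretching persists in windowed log-time mean at levels β ↑ κ⋆² on windows of unbounded log-length along
Type-I singular flows (the scenario P of the module docstring), then an extremal ancient solution exists (module docstring).
Mechanism (card §Stubs): choose β_n ↑ κ⋆², L_n ↑ ∞, flows u_n and windows; centre at an efficient time t_n near the argmax of
the Leray number m(t) = ‖u(t)‖∞√(T−t)/√ν over the window (so the KNSS-rescaled flow is bounded by 2 backward, whatever the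
Type-I constant C_n), at a point of the heavy near-extremal piece; SCALE LOCK: in a near-extremal window with the enstrophy
keeping Leray's pace, the dissipation length ℓ = √(Z/P) is comparable to the parabolic length √(ν(T−t)) on a set of times of
positive log-density (d log Z/ds ≤ 2κ⋆m/ℓ̃ − 2/ℓ̃², ℓ̃ = ℓ/√(ν(T−t)), forces ℓ̃ ∈ [2κ⋆m ∓ 2√(κ⋆²m²−1)] where Z grows), so
the rescaled viscosity stays 1 and the efficient structure lives at the parabolic scale; KNSS C^∞_loc compactness of bounded
Oseen-mild sequences (tree `isKNSSBlowupLimit_of_oseenMild_zoom`, `KNSS2009_lemma61_*`) gives the limit W in the Oseen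
gauge; TIGHTNESS of near-maximisers of R (splitting far-apart pieces is R-neutral only at equal amplitude and equal Z/P
ratio — Cauchy–Schwarz — so every heavy piece of a near-extremal field is near-extremal) and Fatou on the followed piece give
extremal slices for a.e. time of an interval around the centring time.
Why it might fail: loss of tightness (the efficient structure at time t and at time t' are different structures escaping to
infinity from each other in rescaled units — then only one instant survives); or the followed piece loses finite (Z,P) in the
limit (enstrophy spread over ≫ parabolic scales); or near-extremal windows realise their mean by SHORT bursts at scales
≪ parabolic (ℓ̃ → 0 on the efficient set, Euler scaling) — the scale-lock inequality bounds this only where Z grows. -/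
theorem stub_extremalPersistenceCompactness :
    (∀ β : ℝ, β < (sInf {κ : ℝ | (∀ (v : EuclideanSpace ℝ (Fin 3) → EuclideanSpace ℝ (Fin 3)) (M B : ℝ), ContDiff ℝ (⊤ : ℕ∞) v → Literature.Analysis.FluidPDE.VectorCalculus.IsDivFree v → (∀ x, ‖v x‖ ≤ M) → (∀ x, ‖fderiv ℝ v x‖ ≤ B) → (∫⁻ x, ‖iteratedFDeriv ℝ 0 v x‖ₑ ^ 2 < ⊤) → (∫⁻ x, ‖iteratedFDeriv ℝ 1 v x‖ₑ ^ 2 < ⊤) → (∫⁻ x, ‖iteratedFDeriv ℝ 2 v x‖ₑ ^ 2 < ⊤) → |∫ x, ⟪Literature.Analysis.FluidPDE.curl v x, fderiv ℝ v x (Literature.Analysis.FluidPDE.curl v x)⟫_ℝ| ≤ κ * M * Real.sqrt (∫ x, ‖Literature.Analysis.FluidPDE.curl v x‖ ^ 2) * Real.sqrt (∫ x, Literature.Analysis.FluidPDE.frobeniusNormSq (fderiv ℝ (Literature.Analysis.FluidPDE.curl v) x)))}) ^ 2 → ∀ L : ℝ, 0 < L → ∃ (C ν T : ℝ) (u : ℝ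 → EuclideanSpace ℝ (Fin 3) → EuclideanSpace ℝ (Fin 3)) (p : ℝ → EuclideanSpace ℝ (Fin 3) → ℝ), 0 < C ∧ 0 < ν ∧ 0 < T ∧ Literature.Analysis.FluidPDE.IsClassicalNSSolutionOn (Set.Ico 0 T) ν 0 u p ∧ Literature.Analysis.FluidPDE.IsLerayHopfOn T ν 0 (u 0) u ∧ Literature.Analysis.FluidPDE.HasRapidSpatialDecay (u 0) ∧ (∀ᶠ t in 𝓝[<] T, ∀ x, Real.sqrt (T - t) * ‖u t x‖ ≤ C * Real.sqrt ν) ∧ ¬ Literature.Analysis.FluidPDE.HasSmoothExtensionPast ν 0 u T ∧ ∀ (k : ℝ → ℝ), Measurable k → (∀ τ, 0 ≤ k τ ∧ k τ ≤ 1) → (∀ t ∈ Set.Ico 0 T, ∀ M : ℝ, (∀ x, ‖u t x‖ ≤ M) → |∫ x, ⟪Literature.Analysis.FluidPDE.curl (u t) x, fderiv ℝ (u t) x (Literature.Analysis.FluidPDE.curl (u t) x)⟫_ℝ| ≤ k t * M * Real.sqrt (∫ x, ‖Literature.Analysis.FluidPDE.curl (u t) x‖ ^ 2) * Real.sqrt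 (∫ x, Literature.Analysis.FluidPDE.frobeniusNormSq (fderiv ℝ (Literature.Analysis.FluidPDE.curl (u t)) x))) → ∀ t₁ ∈ Set.Ico 0 T, ∃ s₁ s₂ : ℝ, t₁ ≤ s₁ ∧ s₁ < s₂ ∧ s₂ < T ∧ L ≤ Real.log ((T - s₁) / (T - s₂)) ∧ β * Real.log ((T - s₁) / (T - s₂)) < ∫ τ in s₁..s₂, k τ ^ 2 / (T - τ)) → ∃ (W : ℝ → EuclideanSpace ℝ (Fin 3) → EuclideanSpace ℝ (Fin 3)) (a b : ℝ), (Literature.Analysis.FluidPDE.IsKNSSBlowupLimit W ∧ (∀ s t : ℝ, s < t → t < 0 → ∀ x, W t x = Literature.Analysis.FluidPDE.heatFlow (W s) (t - s) x - Literature.Analysis.FluidPDE.oseenDuhamel 1 s W W t x)) ∧ a < b ∧ b ≤ 0 ∧ ∀ᵐ t : ℝ, t ∈ Set.Ioo a b → (ContDiff ℝ (⊤ : ℕ∞) (W t) ∧ Literature.Analysis.FluidPDE.VectorCalculus.IsDivFree (W t) ∧ (∃ B : ℝ, ∀ x, ‖fderiv ℝ (W t) x‖ ≤ B) ∧ (∫⁻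 x, ‖iteratedFDeriv ℝ 1 (W t) x‖ₑ ^ 2 < ⊤) ∧ (∫⁻ x, ‖iteratedFDeriv ℝ 2 (W t) x‖ₑ ^ 2 < ⊤) ∧ ∃ M : ℝ, (∀ x, ‖(W t) x‖ ≤ M) ∧ 0 < M * Real.sqrt (∫ x, ‖Literature.Analysis.FluidPDE.curl (W t) x‖ ^ 2) * Real.sqrt (∫ x, Literature.Analysis.FluidPDE.frobeniusNormSq (fderiv ℝ (Literature.Analysis.FluidPDE.curl (W t)) x)) ∧ (sInf {κ : ℝ | (∀ (v : EuclideanSpace ℝ (Fin 3) → EuclideanSpace ℝ (Fin 3)) (M B : ℝ), ContDiff ℝ (⊤ : ℕ∞) v → Literature.Analysis.FluidPDE.VectorCalculus.IsDivFree v → (∀ x, ‖v x‖ ≤ M) → (∀ x, ‖fderiv ℝ v x‖ ≤ B) → (∫⁻ x, ‖iteratedFDeriv ℝ 0 v x‖ₑ ^ 2 < ⊤) → (∫⁻ x, ‖iteratedFDeriv ℝ 1 v x‖ₑ ^ 2 < ⊤) → (∫⁻ x, ‖iteratedFDeriv ℝ 2 v x‖ₑ ^ 2 < ⊤) → |∫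 x, ⟪Literature.Analysis.FluidPDE.curl v x, fderiv ℝ v x (Literature.Analysis.FluidPDE.curl v x)⟫_ℝ| ≤ κ * M * Real.sqrt (∫ x, ‖Literature.Analysis.FluidPDE.curl v x‖ ^ 2) * Real.sqrt (∫ x, Literature.Analysis.FluidPDE.frobeniusNormSq (fderiv ℝ (Literature.Analysis.FluidPDE.curl v) x)))}) * M * Real.sqrt (∫ x, ‖Literature.Analysis.FluidPDE.curl (W t) x‖ ^ 2) * Real.sqrt (∫ x, Literature.Analysis.FluidPDE.frobeniusNormSq (fderiv ℝ (Literature.Analysis.FluidPDE.curl (W t)) x)) ≤ |∫ x, ⟪Literature.Analysis.FluidPDE.curl (W t) x, fderiv ℝ (W t) x (Literature.Analysis.FluidPDE.curl (W t) x)⟫_ℝ|) := by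
  sorry

/-- **K1a · stub_analyticSlices (support-sized stub, M/L; a known mechanism to be landed).**  Slices of a KNSS blow-up limit in
the Oseen gauge are REAL-ANALYTIC in space at every negative time (KNSS 2009 §4: bounded mild solutions are C^∞ with bounds;
spatial analyticity of mild solutions with bounded data by the complex Picard/Oseen scheme — Masuda 1967, Giga–Sawada 2003,
Dong–Li; tree: `Literature.Analysis.FluidPDE.OseenSchemeRealAnalytic` (real boosts of the complex Oseen scheme) and
`typeI_mild_analyticOnNhd` for the Type-I ancient class — the bounded class runs the same scheme on a unit window).
Why it might fail: it should not; the only work is running the tree's complex Oseen scheme from bounded (not decaying) data. -/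
theorem stub_analyticSlices :
    ∀ (W : ℝ → EuclideanSpace ℝ (Fin 3) → EuclideanSpace ℝ (Fin 3)), (Literature.Analysis.FluidPDE.IsKNSSBlowupLimit W ∧ (∀ s t : ℝ, s < t → t < 0 → ∀ x, W t x = Literature.Analysis.FluidPDE.heatFlow (W s) (t - s) x - Literature.Analysis.FluidPDE.oseenDuhamel 1 s W W t x)) → ∀ t : ℝ, t < 0 → AnalyticOnNhd ℝ (W t) Set.univ := by
  sorry

/-- **K1b · stub_noAnalyticExtremal (crux, L; STATIC — no Navier–Stokes).**  No real-analytic, smooth, divergence-free,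
bounded field on ℝ³ with bounded gradient and finite enstrophy/palinstrophy is non-trivially κ⋆-EFFICIENT
(κ⋆·M·√Z·√P ≤ |∫⟪ω, Dw ω⟫| for a bound M ≥ |w|) — WITHOUT assuming w ∈ L².  The tree proves the L² case at EQUALITY:
`DepletionLadder.KStar.not_attained_of_analyticOnNhd` (an analytic admissible field cannot attain κ⋆: an attainer carries a
plateau {|v| = M} with non-empty interior, `KStar.interior_contact_nonempty` / `plateau_of_kStarAttained`, impossible for an
analytic non-constant |v|² with v ∈ L²).  The extension needed here is exactly ONE new variational fact, «NO GAIN FROM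
CONSTANTS»: a bounded field with curl ∈ L² and div = 0 is b + v with v in the homogeneous admissible class (Biot–Savart,
v ∈ L⁶), its efficiency is R[v]·‖v‖∞/‖v + b‖∞, and the claim is that near-maximisers of R cannot lower their sup norm by a
constant shift (their near-maximal-speed directions are not contained in an open hemisphere — true for the numerically
extreme states, colliding coaxial vortex rings, by axisymmetry + reflection), i.e. the sharp constant of the constant-
extended class equals κ⋆; then a κ⋆-efficient extended field is an extended maximiser, the KKT/plateau analysis of
`…KStarAttained{EulerLagrange,Multiplier,Contact,ActivePlateau}` re-runs in the homogeneous class, and analyticity excludes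
the plateau.
Why it might fail: GAIN FROM CONSTANTS — if some near-maximising sequence of R has speed-range Chebyshev ratio
ρ = min_b ‖v+b‖∞/‖v‖∞ ≤ 1 − δ (one-sided jets), then analytic (band-limited) near-maximisers shifted by the optimal constant are
κ⋆/ρ-efficient and K1b is FALSE as typed (instrument row of the card; the line would then need the dynamic K1 directly). -/
theorem stub_noAnalyticExtremal :
    ¬ ∃ (w : EuclideanSpace ℝ (Fin 3) → EuclideanSpace ℝ (Fin 3)), AnalyticOnNhd ℝ w Set.univ ∧ (ContDiff ℝ (⊤ : ℕ∞) w ∧ Literature.Analysis.FluidPDE.VectorCalculus.IsDivFree w ∧ (∃ B : ℝ, ∀ x, ‖fderiv ℝ w x‖ ≤ B) ∧ (∫⁻ x, ‖iteratedFDeriv ℝ 1 w x‖ₑ ^ 2 < ⊤) ∧ (∫⁻ x, ‖iteratedFDeriv ℝ 2 w x‖ₑ ^ 2 < ⊤) ∧ ∃ M : ℝ, (∀ x, ‖w x‖ ≤ M) ∧ 0 < M * Real.sqrt (∫ x, ‖Literature.Analysis.FluidPDE.curl w x‖ ^ 2) * Real.sqrt (∫ x, Literature.Analysis.FluidPDE.frobeniusNormSq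 (fderiv ℝ (Literature.Analysis.FluidPDE.curl w) x)) ∧ (sInf {κ : ℝ | (∀ (v : EuclideanSpace ℝ (Fin 3) → EuclideanSpace ℝ (Fin 3)) (M B : ℝ), ContDiff ℝ (⊤ : ℕ∞) v → Literature.Analysis.FluidPDE.VectorCalculus.IsDivFree v → (∀ x, ‖v x‖ ≤ M) → (∀ x, ‖fderiv ℝ v x‖ ≤ B) → (∫⁻ x, ‖iteratedFDeriv ℝ 0 v x‖ₑ ^ 2 < ⊤) → (∫⁻ x, ‖iteratedFDeriv ℝ 1 v x‖ₑ ^ 2 < ⊤) → (∫⁻ x, ‖iteratedFDeriv ℝ 2 v x‖ₑ ^ 2 < ⊤) → |∫ x, ⟪Literature.Analysis.FluidPDE.curl v x, fderiv ℝ v x (Literature.Analysis.FluidPDE.curl v x)⟫_ℝ| ≤ κ * M * Real.sqrt (∫ x, ‖Literature.Analysis.FluidPDE.curl v x‖ ^ 2) * Real.sqrt (∫ x, Literature.Analysis.FluidPDE.frobeniusNormSq (fderiv ℝ (Literature.Analysis.FluidPDE.curl v) x)))}) * M * Real.sqrt (∫ x, ‖Literature.Analysis.FluidPDE.curl w x‖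 ^ 2) * Real.sqrt (∫ x, Literature.Analysis.FluidPDE.frobeniusNormSq (fderiv ℝ (Literature.Analysis.FluidPDE.curl w) x)) ≤ |∫ x, ⟪Literature.Analysis.FluidPDE.curl w x, fderiv ℝ w x (Literature.Analysis.FluidPDE.curl w x)⟫_ℝ|) := by
  sorry

/-- **Rigidity, dynamic form (PROVED from K1a, K1b): no extremal ancient solution exists.**  From a.e.-extremality on a time
interval of positive length pick one extremal time t < 0 (`ae_iff`, `Real.volume_Ioo`), read off the extremal slice, and hand
the analytic (K1a) extremal field W(t) to K1b. -/
theorem extremalAncient_false_of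
    (h1a : ∀ (W : ℝ → EuclideanSpace ℝ (Fin 3) → EuclideanSpace ℝ (Fin 3)), (Literature.Analysis.FluidPDE.IsKNSSBlowupLimit W ∧ (∀ s t : ℝ, s < t → t < 0 → ∀ x, W t x = Literature.Analysis.FluidPDE.heatFlow (W s) (t - s) x - Literature.Analysis.FluidPDE.oseenDuhamel 1 s W W t x)) → ∀ t : ℝ, t < 0 → AnalyticOnNhd ℝ (W t) Set.univ)
    (h1b : ¬ ∃ (w : EuclideanSpace ℝ (Fin 3) → EuclideanSpace ℝ (Fin 3)), AnalyticOnNhd ℝ w Set.univ ∧ (ContDiff ℝ (⊤ : ℕ∞) w ∧ Literature.Analysis.FluidPDE.VectorCalculus.IsDivFree w ∧ (∃ B : ℝ, ∀ x, ‖fderiv ℝ w x‖ ≤ B) ∧ (∫⁻ x, ‖iteratedFDeriv ℝ 1 w x‖ₑ ^ 2 < ⊤) ∧ (∫⁻ x, ‖iteratedFDeriv ℝ 2 w x‖ₑ ^ 2 < ⊤) ∧ ∃ M : ℝ, (∀ x, ‖w x‖ ≤ M) ∧ 0 < M * Real.sqrt (∫ x, ‖Literature.Analysis.FluidPDE.curl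 w x‖ ^ 2) * Real.sqrt (∫ x, Literature.Analysis.FluidPDE.frobeniusNormSq (fderiv ℝ (Literature.Analysis.FluidPDE.curl w) x)) ∧ (sInf {κ : ℝ | (∀ (v : EuclideanSpace ℝ (Fin 3) → EuclideanSpace ℝ (Fin 3)) (M B : ℝ), ContDiff ℝ (⊤ : ℕ∞) v → Literature.Analysis.FluidPDE.VectorCalculus.IsDivFree v → (∀ x, ‖v x‖ ≤ M) → (∀ x, ‖fderiv ℝ v x‖ ≤ B) → (∫⁻ x, ‖iteratedFDeriv ℝ 0 v x‖ₑ ^ 2 < ⊤) → (∫⁻ x, ‖iteratedFDeriv ℝ 1 v x‖ₑ ^ 2 < ⊤) → (∫⁻ x, ‖iteratedFDeriv ℝ 2 v x‖ₑ ^ 2 < ⊤) → |∫ x, ⟪Literature.Analysis.FluidPDE.curl v x, fderiv ℝ v x (Literature.Analysis.FluidPDE.curl v x)⟫_ℝ| ≤ κ * M * Real.sqrt (∫ x, ‖Literature.Analysis.FluidPDE.curl v x‖ ^ 2) * Real.sqrt (∫ x, Literature.Analysis.FluidPDE.frobeniusNormSq (fderiv ℝ (Literature.Analysis.FluidPDE.curl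 v) x)))}) * M * Real.sqrt (∫ x, ‖Literature.Analysis.FluidPDE.curl w x‖ ^ 2) * Real.sqrt (∫ x, Literature.Analysis.FluidPDE.frobeniusNormSq (fderiv ℝ (Literature.Analysis.FluidPDE.curl w) x)) ≤ |∫ x, ⟪Literature.Analysis.FluidPDE.curl w x, fderiv ℝ w x (Literature.Analysis.FluidPDE.curl w x)⟫_ℝ|)) :
    ¬ (∃ (W : ℝ → EuclideanSpace ℝ (Fin 3) → EuclideanSpace ℝ (Fin 3)) (a b : ℝ), (Literature.Analysis.FluidPDE.IsKNSSBlowupLimit W ∧ (∀ s t : ℝ, s < t → t < 0 → ∀ x, W t x = Literature.Analysis.FluidPDE.heatFlow (W s) (t - s) x - Literature.Analysis.FluidPDE.oseenDuhamel 1 s W W t x)) ∧ a < b ∧ b ≤ 0 ∧ ∀ᵐ t : ℝ, t ∈ Set.Ioo a b → (ContDiff ℝ (⊤ : ℕ∞) (W t) ∧ Literature.Analysis.FluidPDE.VectorCalculus.IsDivFree (W t) ∧ (∃ B : ℝ, ∀ x, ‖fderiv ℝ (W t) x‖ ≤ B) ∧ (∫⁻ x, ‖iteratedFDeriv ℝ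 1 (W t) x‖ₑ ^ 2 < ⊤) ∧ (∫⁻ x, ‖iteratedFDeriv ℝ 2 (W t) x‖ₑ ^ 2 < ⊤) ∧ ∃ M : ℝ, (∀ x, ‖(W t) x‖ ≤ M) ∧ 0 < M * Real.sqrt (∫ x, ‖Literature.Analysis.FluidPDE.curl (W t) x‖ ^ 2) * Real.sqrt (∫ x, Literature.Analysis.FluidPDE.frobeniusNormSq (fderiv ℝ (Literature.Analysis.FluidPDE.curl (W t)) x)) ∧ (sInf {κ : ℝ | (∀ (v : EuclideanSpace ℝ (Fin 3) → EuclideanSpace ℝ (Fin 3)) (M B : ℝ), ContDiff ℝ (⊤ : ℕ∞) v → Literature.Analysis.FluidPDE.VectorCalculus.IsDivFree v → (∀ x, ‖v x‖ ≤ M) → (∀ x, ‖fderiv ℝ v x‖ ≤ B) → (∫⁻ x, ‖iteratedFDeriv ℝ 0 v x‖ₑ ^ 2 < ⊤) → (∫⁻ x, ‖iteratedFDeriv ℝ 1 v x‖ₑ ^ 2 < ⊤) → (∫⁻ x, ‖iteratedFDeriv ℝ 2 v x‖ₑ ^ 2 < ⊤) → |∫ x, ⟪Literature.Analysis.FluidPDE.curl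 v x, fderiv ℝ v x (Literature.Analysis.FluidPDE.curl v x)⟫_ℝ| ≤ κ * M * Real.sqrt (∫ x, ‖Literature.Analysis.FluidPDE.curl v x‖ ^ 2) * Real.sqrt (∫ x, Literature.Analysis.FluidPDE.frobeniusNormSq (fderiv ℝ (Literature.Analysis.FluidPDE.curl v) x)))}) * M * Real.sqrt (∫ x, ‖Literature.Analysis.FluidPDE.curl (W t) x‖ ^ 2) * Real.sqrt (∫ x, Literature.Analysis.FluidPDE.frobeniusNormSq (fderiv ℝ (Literature.Analysis.FluidPDE.curl (W t)) x)) ≤ |∫ x, ⟪Literature.Analysis.FluidPDE.curl (W t) x, fderiv ℝ (W t) x (Literature.Analysis.FluidPDE.curl (W t) x)⟫_ℝ|)) := by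
  rintro ⟨W, a, b, hW, hab, hb0, hae⟩
  have hex : ∃ t ∈ Set.Ioo a b, (ContDiff ℝ (⊤ : ℕ∞) (W t) ∧ Literature.Analysis.FluidPDE.VectorCalculus.IsDivFree (W t) ∧ (∃ B : ℝ, ∀ x, ‖fderiv ℝ (W t) x‖ ≤ B) ∧ (∫⁻ x, ‖iteratedFDeriv ℝ 1 (W t) x‖ₑ ^ 2 < ⊤) ∧ (∫⁻ x, ‖iteratedFDeriv ℝ 2 (W t) x‖ₑ ^ 2 < ⊤) ∧ ∃ M : ℝ, (∀ x, ‖(W t) x‖ ≤ M) ∧ 0 < M * Real.sqrt (∫ x, ‖Literature.Analysis.FluidPDE.curl (W t) x‖ ^ 2) * Real.sqrt (∫ x, Literature.Analysis.FluidPDE.frobeniusNormSq (fderiv ℝ (Literature.Analysis.FluidPDE.curl (W t)) x)) ∧ (sInf {κ : ℝ | (∀ (v : EuclideanSpace ℝ (Fin 3) → EuclideanSpace ℝ (Fin 3)) (M B : ℝ), ContDiff ℝ (⊤ : ℕ∞) v → Literature.Analysis.FluidPDE.VectorCalculus.IsDivFree v → (∀ x, ‖v x‖ ≤ M) → (∀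 x, ‖fderiv ℝ v x‖ ≤ B) → (∫⁻ x, ‖iteratedFDeriv ℝ 0 v x‖ₑ ^ 2 < ⊤) → (∫⁻ x, ‖iteratedFDeriv ℝ 1 v x‖ₑ ^ 2 < ⊤) → (∫⁻ x, ‖iteratedFDeriv ℝ 2 v x‖ₑ ^ 2 < ⊤) → |∫ x, ⟪Literature.Analysis.FluidPDE.curl v x, fderiv ℝ v x (Literature.Analysis.FluidPDE.curl v x)⟫_ℝ| ≤ κ * M * Real.sqrt (∫ x, ‖Literature.Analysis.FluidPDE.curl v x‖ ^ 2) * Real.sqrt (∫ x, Literature.Analysis.FluidPDE.frobeniusNormSq (fderiv ℝ (Literature.Analysis.FluidPDE.curl v) x)))}) * M * Real.sqrt (∫ x, ‖Literature.Analysis.FluidPDE.curl (W t) x‖ ^ 2) * Real.sqrt (∫ x, Literature.Analysis.FluidPDE.frobeniusNormSq (fderiv ℝ (Literature.Analysis.FluidPDE.curl (W t)) x)) ≤ |∫ x, ⟪Literature.Analysis.FluidPDE.curl (W t) x, fderiv ℝ (W t) x (Literature.Analysis.FluidPDE.curl (W t) x)⟫_ℝ|) := by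
    by_contra hno
    have hsub : Set.Ioo a b ⊆ {t : ℝ | ¬ (t ∈ Set.Ioo a b → (ContDiff ℝ (⊤ : ℕ∞) (W t) ∧ Literature.Analysis.FluidPDE.VectorCalculus.IsDivFree (W t) ∧ (∃ B : ℝ, ∀ x, ‖fderiv ℝ (W t) x‖ ≤ B) ∧ (∫⁻ x, ‖iteratedFDeriv ℝ 1 (W t) x‖ₑ ^ 2 < ⊤) ∧ (∫⁻ x, ‖iteratedFDeriv ℝ 2 (W t) x‖ₑ ^ 2 < ⊤) ∧ ∃ M : ℝ, (∀ x, ‖(W t) x‖ ≤ M) ∧ 0 < M * Real.sqrt (∫ x, ‖Literature.Analysis.FluidPDE.curl (W t) x‖ ^ 2) * Real.sqrt (∫ x, Literature.Analysis.FluidPDE.frobeniusNormSq (fderiv ℝ (Literature.Analysis.FluidPDE.curl (W t)) x)) ∧ (sInf {κ : ℝ | (∀ (v : EuclideanSpace ℝ (Fin 3) → EuclideanSpace ℝ (Fin 3)) (M B : ℝ), ContDiff ℝ (⊤ : ℕ∞) v → Literature.Analysis.FluidPDE.VectorCalculus.IsDivFree v → (∀ x, ‖v x‖ ≤ M) → (∀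 x, ‖fderiv ℝ v x‖ ≤ B) → (∫⁻ x, ‖iteratedFDeriv ℝ 0 v x‖ₑ ^ 2 < ⊤) → (∫⁻ x, ‖iteratedFDeriv ℝ 1 v x‖ₑ ^ 2 < ⊤) → (∫⁻ x, ‖iteratedFDeriv ℝ 2 v x‖ₑ ^ 2 < ⊤) → |∫ x, ⟪Literature.Analysis.FluidPDE.curl v x, fderiv ℝ v x (Literature.Analysis.FluidPDE.curl v x)⟫_ℝ| ≤ κ * M * Real.sqrt (∫ x, ‖Literature.Analysis.FluidPDE.curl v x‖ ^ 2) * Real.sqrt (∫ x, Literature.Analysis.FluidPDE.frobeniusNormSq (fderiv ℝ (Literature.Analysis.FluidPDE.curl v) x)))}) * M * Real.sqrt (∫ x, ‖Literature.Analysis.FluidPDE.curl (W t) x‖ ^ 2) * Real.sqrt (∫ x, Literature.Analysis.FluidPDE.frobeniusNormSq (fderiv ℝ (Literature.Analysis.FluidPDE.curl (W t)) x)) ≤ |∫ x, ⟪Literature.Analysis.FluidPDE.curl (W t) x, fderiv ℝ (W t) x (Literature.Analysis.FluidPDE.curl (W t) x)⟫_ℝ|))} :=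
      fun t ht himp => hno ⟨t, ht, himp ht⟩
    have h0 : volume (Set.Ioo a b) = 0 := measure_mono_null hsub (ae_iff.mp hae)
    rw [Real.volume_Ioo, ENNReal.ofReal_eq_zero] at h0
    linarith
  obtain ⟨t, ht, hcd, hdiv, hB, h1, h2, M, hM, hpos, hext⟩ := hex
  exact h1b ⟨W t, h1a W hW t (lt_of_lt_of_le ht.2 hb0), hcd, hdiv, hB, h1, h2, M, hM, hpos, hext⟩

/-- **Composition (kernel-checked).**  K2 and K1 give ¬P; the rest is the block-to-log bookkeeping described in the module
docstring (`blocksToLog_general`, `intervalIntegrable_coeff_sq_div`, `sharpDepletion_gt`, `sharpDepletion_le`), with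
θ := √(max β 0)/κ⋆ and B := max β 0 · L. -/
theorem NearExtremalTransience_of :
    Summit.NavierStokesRegularity.NavierStokesRegularity.Theses.ExtremiserTransience.NearExtremalTransience := by
  -- COMPACTNESS (stub K2) and RIGIDITY (proved above from the stubs K1a, K1b): the registered stubs enter BY NAME.
  have hK2 : (∀ β : ℝ, β < (sInf {κ : ℝ | (∀ (v : EuclideanSpace ℝ (Fin 3) → EuclideanSpace ℝ (Fin 3)) (M B : ℝ), ContDiff ℝ (⊤ : ℕ∞) v → Literature.Analysis.FluidPDE.VectorCalculus.IsDivFree v → (∀ x, ‖v x‖ ≤ M) → (∀ x, ‖fderiv ℝ v x‖ ≤ B) → (∫⁻ x, ‖iteratedFDeriv ℝ 0 v x‖ₑ ^ 2 < ⊤) → (∫⁻ x, ‖iteratedFDeriv ℝ 1 v x‖ₑ ^ 2 < ⊤) → (∫⁻ x, ‖iteratedFDeriv ℝ 2 v x‖ₑ ^ 2 < ⊤) → |∫ x, ⟪Literature.Analysis.FluidPDE.curl v x, fderiv ℝ v x (Literature.Analysis.FluidPDE.curl v x)⟫_ℝ| ≤ κ * M * Real.sqrt (∫ x, ‖Literature.Analysis.FluidPDE.curl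 v x‖ ^ 2) * Real.sqrt (∫ x, Literature.Analysis.FluidPDE.frobeniusNormSq (fderiv ℝ (Literature.Analysis.FluidPDE.curl v) x)))}) ^ 2 → ∀ L : ℝ, 0 < L → ∃ (C ν T : ℝ) (u : ℝ → EuclideanSpace ℝ (Fin 3) → EuclideanSpace ℝ (Fin 3)) (p : ℝ → EuclideanSpace ℝ (Fin 3) → ℝ), 0 < C ∧ 0 < ν ∧ 0 < T ∧ Literature.Analysis.FluidPDE.IsClassicalNSSolutionOn (Set.Ico 0 T) ν 0 u p ∧ Literature.Analysis.FluidPDE.IsLerayHopfOn T ν 0 (u 0) u ∧ Literature.Analysis.FluidPDE.HasRapidSpatialDecay (u 0) ∧ (∀ᶠ t in 𝓝[<] T, ∀ x, Real.sqrt (T - t) * ‖u t x‖ ≤ C * Real.sqrt ν) ∧ ¬ Literature.Analysis.FluidPDE.HasSmoothExtensionPast ν 0 u T ∧ ∀ (k : ℝ → ℝ), Measurable k → (∀ τ, 0 ≤ k τ ∧ k τ ≤ 1) → (∀ t ∈ Set.Ico 0 T, ∀ M : ℝ, (∀ x, ‖u t x‖ ≤ M) → |∫ x, ⟪Literature.Analysis.FluidPDE.curl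 (u t) x, fderiv ℝ (u t) x (Literature.Analysis.FluidPDE.curl (u t) x)⟫_ℝ| ≤ k t * M * Real.sqrt (∫ x, ‖Literature.Analysis.FluidPDE.curl (u t) x‖ ^ 2) * Real.sqrt (∫ x, Literature.Analysis.FluidPDE.frobeniusNormSq (fderiv ℝ (Literature.Analysis.FluidPDE.curl (u t)) x))) → ∀ t₁ ∈ Set.Ico 0 T, ∃ s₁ s₂ : ℝ, t₁ ≤ s₁ ∧ s₁ < s₂ ∧ s₂ < T ∧ L ≤ Real.log ((T - s₁) / (T - s₂)) ∧ β * Real.log ((T - s₁) / (T - s₂)) < ∫ τ in s₁..s₂, k τ ^ 2 / (T - τ)) → ∃ (W : ℝ → EuclideanSpace ℝ (Fin 3) → EuclideanSpace ℝ (Fin 3)) (a b : ℝ), (Literature.Analysis.FluidPDE.IsKNSSBlowupLimit W ∧ (∀ s t : ℝ, s < t → t < 0 → ∀ x, W t x = Literature.Analysis.FluidPDE.heatFlow (W s) (t - s) x - Literature.Analysis.FluidPDE.oseenDuhamel 1 s W W t x)) ∧ a < b ∧ b ≤ 0 ∧ ∀ᵐ t : ℝ, t ∈ Set.Ioo a b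 → (ContDiff ℝ (⊤ : ℕ∞) (W t) ∧ Literature.Analysis.FluidPDE.VectorCalculus.IsDivFree (W t) ∧ (∃ B : ℝ, ∀ x, ‖fderiv ℝ (W t) x‖ ≤ B) ∧ (∫⁻ x, ‖iteratedFDeriv ℝ 1 (W t) x‖ₑ ^ 2 < ⊤) ∧ (∫⁻ x, ‖iteratedFDeriv ℝ 2 (W t) x‖ₑ ^ 2 < ⊤) ∧ ∃ M : ℝ, (∀ x, ‖(W t) x‖ ≤ M) ∧ 0 < M * Real.sqrt (∫ x, ‖Literature.Analysis.FluidPDE.curl (W t) x‖ ^ 2) * Real.sqrt (∫ x, Literature.Analysis.FluidPDE.frobeniusNormSq (fderiv ℝ (Literature.Analysis.FluidPDE.curl (W t)) x)) ∧ (sInf {κ : ℝ | (∀ (v : EuclideanSpace ℝ (Fin 3) → EuclideanSpace ℝ (Fin 3)) (M B : ℝ), ContDiff ℝ (⊤ : ℕ∞) v → Literature.Analysis.FluidPDE.VectorCalculus.IsDivFree v → (∀ x, ‖v x‖ ≤ M) → (∀ x, ‖fderiv ℝ v x‖ ≤ B) → (∫⁻ x, ‖iteratedFDeriv ℝ 0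 v x‖ₑ ^ 2 < ⊤) → (∫⁻ x, ‖iteratedFDeriv ℝ 1 v x‖ₑ ^ 2 < ⊤) → (∫⁻ x, ‖iteratedFDeriv ℝ 2 v x‖ₑ ^ 2 < ⊤) → |∫ x, ⟪Literature.Analysis.FluidPDE.curl v x, fderiv ℝ v x (Literature.Analysis.FluidPDE.curl v x)⟫_ℝ| ≤ κ * M * Real.sqrt (∫ x, ‖Literature.Analysis.FluidPDE.curl v x‖ ^ 2) * Real.sqrt (∫ x, Literature.Analysis.FluidPDE.frobeniusNormSq (fderiv ℝ (Literature.Analysis.FluidPDE.curl v) x)))}) * M * Real.sqrt (∫ x, ‖Literature.Analysis.FluidPDE.curl (W t) x‖ ^ 2) * Real.sqrt (∫ x, Literature.Analysis.FluidPDE.frobeniusNormSq (fderiv ℝ (Literature.Analysis.FluidPDE.curl (W t)) x)) ≤ |∫ x, ⟪Literature.Analysis.FluidPDE.curl (W t) x, fderiv ℝ (W t) x (Literature.Analysis.FluidPDE.curl (W t) x)⟫_ℝ|) := stub_extremalPersistenceCompactness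
  have hK1 : ¬ (∃ (W : ℝ → EuclideanSpace ℝ (Fin 3) → EuclideanSpace ℝ (Fin 3)) (a b : ℝ), (Literature.Analysis.FluidPDE.IsKNSSBlowupLimit W ∧ (∀ s t : ℝ, s < t → t < 0 → ∀ x, W t x = Literature.Analysis.FluidPDE.heatFlow (W s) (t - s) x - Literature.Analysis.FluidPDE.oseenDuhamel 1 s W W t x)) ∧ a < b ∧ b ≤ 0 ∧ ∀ᵐ t : ℝ, t ∈ Set.Ioo a b → (ContDiff ℝ (⊤ : ℕ∞) (W t) ∧ Literature.Analysis.FluidPDE.VectorCalculus.IsDivFree (W t) ∧ (∃ B : ℝ, ∀ x, ‖fderiv ℝ (W t) x‖ ≤ B) ∧ (∫⁻ x, ‖iteratedFDeriv ℝ 1 (W t) x‖ₑ ^ 2 < ⊤) ∧ (∫⁻ x, ‖iteratedFDeriv ℝ 2 (W t) x‖ₑ ^ 2 < ⊤) ∧ ∃ M : ℝ, (∀ x, ‖(W t) x‖ ≤ M) ∧ 0 < M * Real.sqrt (∫ x, ‖Literature.Analysis.FluidPDE.curl (W t) x‖ ^ 2) * Real.sqrt (∫ x, Literature.Analysis.FluidPDE.frobeniusNormSq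 (fderiv ℝ (Literature.Analysis.FluidPDE.curl (W t)) x)) ∧ (sInf {κ : ℝ | (∀ (v : EuclideanSpace ℝ (Fin 3) → EuclideanSpace ℝ (Fin 3)) (M B : ℝ), ContDiff ℝ (⊤ : ℕ∞) v → Literature.Analysis.FluidPDE.VectorCalculus.IsDivFree v → (∀ x, ‖v x‖ ≤ M) → (∀ x, ‖fderiv ℝ v x‖ ≤ B) → (∫⁻ x, ‖iteratedFDeriv ℝ 0 v x‖ₑ ^ 2 < ⊤) → (∫⁻ x, ‖iteratedFDeriv ℝ 1 v x‖ₑ ^ 2 < ⊤) → (∫⁻ x, ‖iteratedFDeriv ℝ 2 v x‖ₑ ^ 2 < ⊤) → |∫ x, ⟪Literature.Analysis.FluidPDE.curl v x, fderiv ℝ v x (Literature.Analysis.FluidPDE.curl v x)⟫_ℝ| ≤ κ * M * Real.sqrt (∫ x, ‖Literature.Analysis.FluidPDE.curl v x‖ ^ 2) * Real.sqrt (∫ x, Literature.Analysis.FluidPDE.frobeniusNormSq (fderiv ℝ (Literature.Analysis.FluidPDE.curl v) x)))}) * M * Real.sqrt (∫ x, ‖Literature.Analysis.FluidPDE.curl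 (W t) x‖ ^ 2) * Real.sqrt (∫ x, Literature.Analysis.FluidPDE.frobeniusNormSq (fderiv ℝ (Literature.Analysis.FluidPDE.curl (W t)) x)) ≤ |∫ x, ⟪Literature.Analysis.FluidPDE.curl (W t) x, fderiv ℝ (W t) x (Literature.Analysis.FluidPDE.curl (W t) x)⟫_ℝ|)) := extremalAncient_false_of stub_analyticSlices stub_noAnalyticExtremal
  have hnotP : ¬ (∀ β : ℝ, β < (sInf {κ : ℝ | (∀ (v : EuclideanSpace ℝ (Fin 3) → EuclideanSpace ℝ (Fin 3)) (M B : ℝ), ContDiff ℝ (⊤ : ℕ∞) v → Literature.Analysis.FluidPDE.VectorCalculus.IsDivFree v → (∀ x, ‖v x‖ ≤ M) → (∀ x, ‖fderiv ℝ v x‖ ≤ B) → (∫⁻ x, ‖iteratedFDeriv ℝ 0 v x‖ₑ ^ 2 < ⊤) → (∫⁻ x, ‖iteratedFDeriv ℝ 1 v x‖ₑ ^ 2 < ⊤) → (∫⁻ x, ‖iteratedFDeriv ℝ 2 v x‖ₑ ^ 2 < ⊤) → |∫ x, ⟪Literature.Analysis.FluidPDE.curl v x, fderiv ℝ v x (Literature.Analysis.FluidPDE.curl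 v x)⟫_ℝ| ≤ κ * M * Real.sqrt (∫ x, ‖Literature.Analysis.FluidPDE.curl v x‖ ^ 2) * Real.sqrt (∫ x, Literature.Analysis.FluidPDE.frobeniusNormSq (fderiv ℝ (Literature.Analysis.FluidPDE.curl v) x)))}) ^ 2 → ∀ L : ℝ, 0 < L → ∃ (C ν T : ℝ) (u : ℝ → EuclideanSpace ℝ (Fin 3) → EuclideanSpace ℝ (Fin 3)) (p : ℝ → EuclideanSpace ℝ (Fin 3) → ℝ), 0 < C ∧ 0 < ν ∧ 0 < T ∧ Literature.Analysis.FluidPDE.IsClassicalNSSolutionOn (Set.Ico 0 T) ν 0 u p ∧ Literature.Analysis.FluidPDE.IsLerayHopfOn T ν 0 (u 0) u ∧ Literature.Analysis.FluidPDE.HasRapidSpatialDecay (u 0) ∧ (∀ᶠ t in 𝓝[<] T, ∀ x, Real.sqrt (T - t) * ‖u t x‖ ≤ C * Real.sqrt ν) ∧ ¬ Literature.Analysis.FluidPDE.HasSmoothExtensionPast ν 0 u T ∧ ∀ (k : ℝ → ℝ), Measurable k → (∀ τ, 0 ≤ k τ ∧ k τ ≤ 1) → (∀ t ∈ Set.Ico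 0 T, ∀ M : ℝ, (∀ x, ‖u t x‖ ≤ M) → |∫ x, ⟪Literature.Analysis.FluidPDE.curl (u t) x, fderiv ℝ (u t) x (Literature.Analysis.FluidPDE.curl (u t) x)⟫_ℝ| ≤ k t * M * Real.sqrt (∫ x, ‖Literature.Analysis.FluidPDE.curl (u t) x‖ ^ 2) * Real.sqrt (∫ x, Literature.Analysis.FluidPDE.frobeniusNormSq (fderiv ℝ (Literature.Analysis.FluidPDE.curl (u t)) x))) → ∀ t₁ ∈ Set.Ico 0 T, ∃ s₁ s₂ : ℝ, t₁ ≤ s₁ ∧ s₁ < s₂ ∧ s₂ < T ∧ L ≤ Real.log ((T - s₁) / (T - s₂)) ∧ β * Real.log ((T - s₁) / (T - s₂)) < ∫ τ in s₁..s₂, k τ ^ 2 / (T - τ)) := fun hP => hK1 (hK2 hP)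
  -- Step 1: the uniform level β < κ⋆² and log-length L > 0.
  obtain ⟨β, hβ⟩ := not_forall.mp hnotP
  obtain ⟨hβlt, hβ2⟩ := Classical.not_imp.mp hβ
  obtain ⟨L, hL⟩ := not_forall.mp hβ2
  obtain ⟨hLpos, hrest⟩ := Classical.not_imp.mp hL
  -- constants of the sharp-constant API
  have hκgt : (13 : ℝ) / 200 < sInf {κ : ℝ | (∀ (v : EuclideanSpace ℝ (Fin 3) → EuclideanSpace ℝ (Fin 3)) (M B : ℝ), ContDiff ℝ (⊤ : ℕ∞) v → Literature.Analysis.FluidPDE.VectorCalculus.IsDivFree v → (∀ x, ‖v x‖ ≤ M) → (∀ x, ‖fderiv ℝ v x‖ ≤ B) → (∫⁻ x, ‖iteratedFDeriv ℝ 0 v x‖ₑ ^ 2 < ⊤) → (∫⁻ x, ‖iteratedFDeriv ℝ 1 v x‖ₑ ^ 2 < ⊤) → (∫⁻ x, ‖iteratedFDeriv ℝ 2 v x‖ₑ ^ 2 < ⊤) → |∫ x, ⟪Literature.Analysis.FluidPDE.curl v x, fderiv ℝ v x (Literature.Analysis.FluidPDE.curl v x)⟫_ℝ| ≤ κ * M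 * Real.sqrt (∫ x, ‖Literature.Analysis.FluidPDE.curl v x‖ ^ 2) * Real.sqrt (∫ x, Literature.Analysis.FluidPDE.frobeniusNormSq (fderiv ℝ (Literature.Analysis.FluidPDE.curl v) x)))} := sharpDepletion_gt
  have hκpos : (0 : ℝ) < sInf {κ : ℝ | (∀ (v : EuclideanSpace ℝ (Fin 3) → EuclideanSpace ℝ (Fin 3)) (M B : ℝ), ContDiff ℝ (⊤ : ℕ∞) v → Literature.Analysis.FluidPDE.VectorCalculus.IsDivFree v → (∀ x, ‖v x‖ ≤ M) → (∀ x, ‖fderiv ℝ v x‖ ≤ B) → (∫⁻ x, ‖iteratedFDeriv ℝ 0 v x‖ₑ ^ 2 < ⊤) → (∫⁻ x, ‖iteratedFDeriv ℝ 1 v x‖ₑ ^ 2 < ⊤) → (∫⁻ x, ‖iteratedFDeriv ℝ 2 v x‖ₑ ^ 2 < ⊤) → |∫ x, ⟪Literature.Analysis.FluidPDE.curl v x, fderiv ℝ v x (Literature.Analysis.FluidPDE.curl v x)⟫_ℝ| ≤ κ * M * Real.sqrt (∫ x, ‖Literature.Analysis.FluidPDE.curl v x‖ ^ 2) * Real.sqrt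 (∫ x, Literature.Analysis.FluidPDE.frobeniusNormSq (fderiv ℝ (Literature.Analysis.FluidPDE.curl v) x)))} := lt_trans (by norm_num) hκgt
  have hm0 : (0 : ℝ) ≤ max β 0 := le_max_right _ _
  have hA0 : (0 : ℝ) ≤ max β 0 * L := mul_nonneg hm0 hLpos.le
  refine ⟨Real.sqrt (max β 0) / sInf {κ : ℝ | (∀ (v : EuclideanSpace ℝ (Fin 3) → EuclideanSpace ℝ (Fin 3)) (M B : ℝ), ContDiff ℝ (⊤ : ℕ∞) v → Literature.Analysis.FluidPDE.VectorCalculus.IsDivFree v → (∀ x, ‖v x‖ ≤ M) → (∀ x, ‖fderiv ℝ v x‖ ≤ B) → (∫⁻ x, ‖iteratedFDeriv ℝ 0 v x‖ₑ ^ 2 < ⊤) → (∫⁻ x, ‖iteratedFDeriv ℝ 1 v x‖ₑ ^ 2 < ⊤) → (∫⁻ x, ‖iteratedFDeriv ℝ 2 v x‖ₑ ^ 2 < ⊤) → |∫ x, ⟪Literature.Analysis.FluidPDE.curl v x, fderiv ℝ v x (Literature.Analysis.FluidPDE.curl v x)⟫_ℝ| ≤ κ * M * Real.sqrt (∫ x,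 ‖Literature.Analysis.FluidPDE.curl v x‖ ^ 2) * Real.sqrt (∫ x, Literature.Analysis.FluidPDE.frobeniusNormSq (fderiv ℝ (Literature.Analysis.FluidPDE.curl v) x)))}, div_nonneg (Real.sqrt_nonneg _) hκpos.le, ?_, ?_⟩
  · rw [div_lt_one hκpos, Real.sqrt_lt' hκpos]
    exact max_lt hβlt (by positivity)
  intro κ hκ C ν T hC hν hT u p hcl hLH hdec hrate hsing
  have hκle : sInf {κ : ℝ | (∀ (v : EuclideanSpace ℝ (Fin 3) → EuclideanSpace ℝ (Fin 3)) (M B : ℝ), ContDiff ℝ (⊤ : ℕ∞) v → Literature.Analysis.FluidPDE.VectorCalculus.IsDivFree v → (∀ x, ‖v x‖ ≤ M) → (∀ x, ‖fderiv ℝ v x‖ ≤ B) → (∫⁻ x, ‖iteratedFDeriv ℝ 0 v x‖ₑ ^ 2 < ⊤) → (∫⁻ x, ‖iteratedFDeriv ℝ 1 v x‖ₑ ^ 2 < ⊤) → (∫⁻ x, ‖iteratedFDeriv ℝ 2 v x‖ₑ ^ 2 < ⊤) → |∫ x, ⟪Literature.Analysis.FluidPDE.curl v x, fderiv ℝ v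 x (Literature.Analysis.FluidPDE.curl v x)⟫_ℝ| ≤ κ * M * Real.sqrt (∫ x, ‖Literature.Analysis.FluidPDE.curl v x‖ ^ 2) * Real.sqrt (∫ x, Literature.Analysis.FluidPDE.frobeniusNormSq (fderiv ℝ (Literature.Analysis.FluidPDE.curl v) x)))} ≤ κ := sharpDepletion_le hκ
  -- Step 2: along this flow, some admissible coefficient k and onset t₁ have only subextremal long windows.
  have hk : ¬ (∀ (k : ℝ → ℝ), Measurable k → (∀ τ, 0 ≤ k τ ∧ k τ ≤ 1) → (∀ t ∈ Set.Ico 0 T, ∀ M : ℝ, (∀ x, ‖u t x‖ ≤ M) → |∫ x, ⟪Literature.Analysis.FluidPDE.curl (u t) x, fderiv ℝ (u t) x (Literature.Analysis.FluidPDE.curl (u t) x)⟫_ℝ| ≤ k t * M * Real.sqrt (∫ x, ‖Literature.Analysis.FluidPDE.curl (u t) x‖ ^ 2) * Real.sqrt (∫ x, Literature.Analysis.FluidPDE.frobeniusNormSq (fderiv ℝ (Literature.Analysis.FluidPDE.curl (u t)) x))) → ∀ t₁ ∈ Set.Ico 0 T, ∃ s₁ s₂ : ℝ, t₁ ≤ s₁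 ∧ s₁ < s₂ ∧ s₂ < T ∧ L ≤ Real.log ((T - s₁) / (T - s₂)) ∧ β * Real.log ((T - s₁) / (T - s₂)) < ∫ τ in s₁..s₂, k τ ^ 2 / (T - τ)) := fun hall =>
    hrest ⟨C, ν, T, u, p, hC, hν, hT, hcl, hLH, hdec, hrate, hsing, hall⟩
  obtain ⟨k, hk1⟩ := not_forall.mp hk
  obtain ⟨hkm, hk2⟩ := Classical.not_imp.mp hk1
  obtain ⟨hk01, hk3⟩ := Classical.not_imp.mp hk2
  obtain ⟨hclause, hk4⟩ := Classical.not_imp.mp hk3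
  obtain ⟨t₁, ht₁'⟩ := not_forall.mp hk4
  obtain ⟨ht₁, hnowin⟩ := Classical.not_imp.mp ht₁'
  have hwin : ∀ s₁ s₂ : ℝ, t₁ ≤ s₁ → s₁ < s₂ → s₂ < T → L ≤ Real.log ((T - s₁) / (T - s₂)) →
      ∫ τ in s₁..s₂, k τ ^ 2 / (T - τ) ≤ β * Real.log ((T - s₁) / (T - s₂)) :=
    fun s₁ s₂ h1 h2 h3 h4 => not_lt.mp fun hlt => hnowin ⟨s₁, s₂, h1, h2, h3, h4, hlt⟩
  have hTt₁ : 0 < T - t₁ := sub_pos.mpr ht₁.2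
  -- Step 3: geometric blocks of log-length exactly L carry mass ≤ max β 0 · L.
  have hblock : ∀ n : ℕ, ∫ τ in (T - (T - t₁) * Real.exp (-(n * L)))..(T - (T - t₁) * Real.exp (-((n + 1) * L))), k τ ^ 2 / (T - τ) ≤ max β 0 * L := by
    intro n
    have hn : (0 : ℝ) ≤ n := n.cast_nonneg
    have he1 : Real.exp (-(n * L)) ≤ 1 := by
      rw [Real.exp_le_one_iff]
      have := mul_nonneg hn hLpos.le
      linarith
    have he2 : Real.exp (-((n + 1) * L)) < Real.exp (-(n * L)) := by
      rw [Real.exp_lt_exp]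
      have : ((n : ℝ) + 1) * L = n * L + L := by ring
      rw [this]
      linarith
    have h1 : t₁ ≤ (T - (T - t₁) * Real.exp (-(n * L))) := by
      have := mul_le_mul_of_nonneg_left he1 hTt₁.le
      linarith
    have h2 : (T - (T - t₁) * Real.exp (-(n * L))) < (T - (T - t₁) * Real.exp (-((n + 1) * L))) := by
      have := mul_lt_mul_of_pos_left he2 hTt₁
      linarith
    have h3 : (T - (T - t₁) * Real.exp (-((n + 1) * L))) < T := by
      have := mul_pos hTt₁ (Real.exp_pos (-((n + 1) * L)))
      linarith
    have hratio : (T - (T - (T - t₁) * Real.exp (-(n * L)))) / (T - (T - (T - t₁) * Real.exp (-((n + 1) * L)))) = Real.exp L := by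
      rw [show T - (T - (T - t₁) * Real.exp (-(n * L))) = (T - t₁) * Real.exp (-(n * L)) by ring,
        show T - (T - (T - t₁) * Real.exp (-((n + 1) * L))) = (T - t₁) * Real.exp (-((n + 1) * L)) by ring,
        mul_div_mul_left _ _ hTt₁.ne', ← Real.exp_sub]
      congr 1
      ring
    have hlog : Real.log ((T - (T - (T - t₁) * Real.exp (-(n * L)))) / (T - (T - (T - t₁) * Real.exp (-((n + 1) * L))))) = L := by
      rw [hratio, Real.log_exp]
    have hw := hwin (T - (T - t₁) * Real.exp (-(n * L))) (T - (T - t₁) * Real.exp (-((n + 1) * L))) h1 h2 h3 (le_of_eq hlog.symm)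
    rw [hlog] at hw
    exact hw.trans (mul_le_mul_of_nonneg_right (le_max_left _ _) hLpos.le)
  -- Step 4: sum the blocks (tree lemma) and restrict the flow-wise clause to [t₁, T).
  have hmain := blocksToLog_general (g := fun τ => k τ ^ 2 / (T - τ)) (t₁ := t₁) (T := T) (A := max β 0 * L) (ℓ := L)
    ht₁.2 hA0 hLpos (fun τ hτ => div_nonneg (sq_nonneg _) (sub_nonneg.mpr (le_of_lt hτ.2)))
    (fun t ht => intervalIntegrable_coeff_sq_div hkm hk01 ht.1 ht.2) hblock
  refine ⟨t₁, ht₁, k, max β 0 * L, hkm, hk01, fun t ht M hM => hclause t ⟨ht₁.1.trans ht.1, ht.2⟩ M hM, fun t ht => ?_⟩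
  have h := hmain t ht
  have hlog0 : 0 ≤ Real.log ((T - t₁) / (T - t)) := by
    apply Real.log_nonneg
    rw [le_div_iff₀ (sub_pos.mpr ht.2)]
    linarith [ht.1]
  have hcoef : max β 0 * L / L ≤ (Real.sqrt (max β 0) / sInf {κ : ℝ | (∀ (v : EuclideanSpace ℝ (Fin 3) → EuclideanSpace ℝ (Fin 3)) (M B : ℝ), ContDiff ℝ (⊤ : ℕ∞) v → Literature.Analysis.FluidPDE.VectorCalculus.IsDivFree v → (∀ x, ‖v x‖ ≤ M) → (∀ x, ‖fderiv ℝ v x‖ ≤ B) → (∫⁻ x, ‖iteratedFDeriv ℝ 0 v x‖ₑ ^ 2 < ⊤) → (∫⁻ x, ‖iteratedFDeriv ℝ 1 v x‖ₑ ^ 2 < ⊤) → (∫⁻ x, ‖iteratedFDeriv ℝ 2 v x‖ₑ ^ 2 < ⊤) → |∫ x, ⟪Literature.Analysis.FluidPDE.curl v x, fderiv ℝ v x (Literature.Analysis.FluidPDE.curl v x)⟫_ℝ| ≤ κ * M * Real.sqrt (∫ x, ‖Literature.Analysis.FluidPDE.curl v x‖ ^ 2) * Real.sqrt (∫ x, Literature.Analysis.FluidPDE.frobeniusNormSq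 (fderiv ℝ (Literature.Analysis.FluidPDE.curl v) x)))} * κ) ^ 2 := by
    rw [mul_div_assoc, div_self hLpos.ne', mul_one, div_mul_eq_mul_div, div_pow, mul_pow, Real.sq_sqrt hm0,
      le_div_iff₀ (pow_pos hκpos 2)]
    exact mul_le_mul_of_nonneg_left (pow_le_pow_left₀ hκpos.le hκle 2) hm0
  exact h.trans (add_le_add (mul_le_mul_of_nonneg_right hcoef hlog0) le_rfl)

-- audit: the composition concludes the crux BY NAME; sorries only in the three stubs.
#print axioms NearExtremalTransience_of

end Summit.NavierStokesRegularity.NavierStokesRegularity.Cruxes.NearExtremalTransience.ExtremiserLiouville
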